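import Summits.NavierStokesRegularity.NavierStokesRegularity.Theorems.CircuitPump.Negative.LoadBearing
import Literature.Analysis.FluidPDE.Tao2016AveragedNS.LocalCascadeSolutions

/-!
# `WakeRatchet.EternalViscousRate` (stmt-NavierStokesRegularity-25647): the TABLE DICTIONARY between the
# perpetual-pump encoding (`PerpetualPump.CircuitPump`, `Option (Fin 3)` shift labels) and Tao's class
# vocabulary (`shiftSet`, `IsSymmetricCoeff`, `IsCancellingCoeff`, `quadTerm`) — brick 2a of the bridge
# «CircuitPump witness ⟹ dissipation-balanced block-DSS bounded admissible eternal solution»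

The closed route PerpetualPump types Tao's circuits with structure constants
`coeff : Fin m → Fin m → Fin m → Option (Fin 3) → ℝ` (`none ↦ (0,0,0)`, `some 0 ↦ (1,0,0)`, `some 1 ↦ (0,1,0)`,
`some 2 ↦ (0,0,1)`), symmetry `CircuitPumpNegative.IsSym`, cyclic cancellation `CircuitPumpNegative.IsCyc` and
right-hand side `CircuitPumpNegative.rhsF lam coeff X i n t` (gain `lam^{n-[μ=e₃]}`, dissipation `-lam^{4n/5}X`),
and PROVES a non-trivial exactly self-similar Type-I solution on `(-∞,0)` at every fine `lam`
(`PerpetualPumpCircuitPump.CircuitPump_proof`).  The WakeRatchet cruxes (⟨25646⟩/⟨25647⟩/⟨22743⟩) quantify over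
Tao-class tables `α : Fin 4 → Fin 4 → Fin 4 → ℤ × ℤ × ℤ → ℝ` with `IsSymmetricCoeff` (4.2),
`IsCancellingCoeff` (4.3) and the motion law `quadTerm ε₀ α X i n t - ν(1+ε₀)^{2n}X` (`ViscousGlobal.motion`).
This file is the dictionary, for ANY number of modes and ANY `coeff`, with the pulled-back table written out
explicitly (no new definition):

* `isSymmetricCoeff_of_isSym` — (4.2) in the class vocabulary from `IsSym`;
* `isCancellingCoeff_of_isCyc` — (4.3) in the class vocabulary from `IsCyc` (the six permutations of `Fin 3`
  against the six index/shift permutations of (4.3), shift label transported by `Option.map σ⁻¹`);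
* `rhsF_eq_quadTerm_sub` — with `lam = (1+ε₀)^{5/2}`: `rhsF lam coeff X i n t = quadTerm ε₀ α X i n t -
  1·(1+ε₀)^{2n}·X_{i,n}(t)`, i.e. `SolvesODE lam coeff X` IS the exact `ν = 1` viscous lattice law of Tao 2016 §4
  on `(-∞,0)` for the pulled-back table.

With brick 1 (`WakeRatchetEternalViscousRateCircuitPumpClock`: lattice type-I clock) these are the algebraic
inputs of the renormalisation `W_n(σ) = Λ^n e^{-σ} X_n(-e^{-σ})` of the pump into an `IsEternalVisc ε₀ 1 α W`,
`UniformBound W`, block-DSS witness (remaining: the chain rule — pattern `ClockedFrames.frame_law` — and the action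
clause).  HONEST LABEL: finite algebra about MODEL lattice ODEs (Tao 2016 §4); no item is closed; nothing here bears
on the Navier–Stokes equations.
-/

set_option linter.dupNamespace false

noncomputable section

open scoped BigOperators
open Real Set

namespace Summit.NavierStokesRegularity.NavierStokesRegularity.Theorems.WakeRatchetCircuitPumpTable

open Summit.NavierStokesRegularity.NavierStokesRegularity.Theorems.CircuitPumpNegative
open Literature.Analysis.FluidPDE Literature.Analysis.FluidPDE.TaoCascade

variable {m : ℕ}

/-- The six permutations of `Fin 3` (restated from `CircuitPump/Negative/WitnessStructure`). [folklore] -/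
private theorem sum_perm_fin_three {M : Type*} [AddCommMonoid M] (g : Equiv.Perm (Fin 3) → M) :
    ∑ σ : Equiv.Perm (Fin 3), g σ =
      g 1 + g (Equiv.swap 0 1) + g (Equiv.swap 0 2) + g (Equiv.swap 1 2) +
        g (Equiv.swap 0 1 * Equiv.swap 1 2) + g (Equiv.swap 1 2 * Equiv.swap 0 1) := by
  have h : (Finset.univ : Finset (Equiv.Perm (Fin 3))) =
      {1, Equiv.swap 0 1, Equiv.swap 0 2, Equiv.swap 1 2, Equiv.swap 0 1 * Equiv.swap 1 2,
        Equiv.swap 1 2 * Equiv.swap 0 1} := by decide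
  rw [h]
  rw [Finset.sum_insert (by decide), Finset.sum_insert (by decide), Finset.sum_insert (by decide),
    Finset.sum_insert (by decide), Finset.sum_insert (by decide), Finset.sum_singleton]
  abel

/-- **(4.2) for the pulled-back table.**  Tao's symmetry `IsSymmetricCoeff` of the table
`(0,0,0) ↦ coeff·none, (1,0,0) ↦ coeff·e₁, (0,1,0) ↦ coeff·e₂, (0,0,1) ↦ coeff·e₃, else 0` from the pump
encoding's `IsSym` (swap of the first two slots = `Option.map (swap 0 1)` on the label).
[cite: Tao2016AveragedNS, §4 (4.2)] -/
theorem isSymmetricCoeff_of_isSym (coeff : Fin m → Fin m → Fin m → Option (Fin 3) → ℝ) (hS : IsSym coeff) :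
    IsSymmetricCoeff (fun (i₁ i₂ i₃ : Fin m) (μ : ℤ × ℤ × ℤ) =>
      if μ = (0, 0, 0) then coeff i₁ i₂ i₃ none
      else if μ = (1, 0, 0) then coeff i₁ i₂ i₃ (some 0)
      else if μ = (0, 1, 0) then coeff i₁ i₂ i₃ (some 1)
      else if μ = (0, 0, 1) then coeff i₁ i₂ i₃ (some 2) else 0) := by
  intro i₁ i₂ i₃ μ₁ μ₂ μ₃ hμ
  rw [mem_shiftSet_iff] at hμ
  have h0 := hS i₁ i₂ i₃ none
  have h1 := hS i₁ i₂ i₃ (some 0)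
  have h2 := hS i₁ i₂ i₃ (some 1)
  have h3 := hS i₁ i₂ i₃ (some 2)
  simp only [Option.map_none, Option.map_some, Equiv.swap_apply_left, Equiv.swap_apply_right,
    Fin.isValue] at h0 h1 h2 h3
  have hsw : (Equiv.swap (0 : Fin 3) 1) 2 = 2 := by decide
  rw [hsw] at h3
  rcases hμ with h | h | h | h <;> simp only [Prod.mk.injEq] at h <;> obtain ⟨rfl, rfl, rfl⟩ := h <;>
    simp [h0, h1, h2, h3]

/-- **(4.3) for the pulled-back table.**  Tao's cancellation `IsCancellingCoeff` from the pump encoding's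
cyclic cancellation `IsCyc` (sum over the six permutations `σ` of the three slots, label transported by
`Option.map σ⁻¹`): on each shift of `shiftSet` the six terms of (4.3) are exactly the six terms of `IsCyc` at
`v = (i₁,i₂,i₃)`.
[cite: Tao2016AveragedNS, §4 (4.3)] -/
theorem isCancellingCoeff_of_isCyc (coeff : Fin m → Fin m → Fin m → Option (Fin 3) → ℝ) (hC : IsCyc coeff) :
    IsCancellingCoeff (fun (i₁ i₂ i₃ : Fin m) (μ : ℤ × ℤ × ℤ) =>
      if μ = (0, 0, 0) then coeff i₁ i₂ i₃ none
      else if μ = (1, 0, 0) then coeff i₁ i₂ i₃ (some 0)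
      else if μ = (0, 1, 0) then coeff i₁ i₂ i₃ (some 1)
      else if μ = (0, 0, 1) then coeff i₁ i₂ i₃ (some 2) else 0) := by
  intro i₁ i₂ i₃ μ₁ μ₂ μ₃ hμ
  rw [mem_shiftSet_iff] at hμ
  have hc1 : (Equiv.swap (0 : Fin 3) 1 * Equiv.swap 1 2).symm = Equiv.swap 1 2 * Equiv.swap 0 1 := by
    decide
  have hc2 : (Equiv.swap (1 : Fin 3) 2 * Equiv.swap 0 1).symm = Equiv.swap 0 1 * Equiv.swap 1 2 := by
    decide
  have h1 : (1 : Equiv.Perm (Fin 3)).symm = 1 := by decide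
  have k0 := hC ![i₁, i₂, i₃] none
  have k1 := hC ![i₁, i₂, i₃] (some 0)
  have k2 := hC ![i₁, i₂, i₃] (some 1)
  have k3 := hC ![i₁, i₂, i₃] (some 2)
  rw [sum_perm_fin_three] at k0 k1 k2 k3
  simp only [Equiv.Perm.mul_apply, Equiv.swap_apply_left, Equiv.swap_apply_right, Equiv.symm_swap, hc1, hc2,
    h1, Equiv.Perm.one_apply, Option.map_none, Option.map_some, Fin.isValue,
    Matrix.cons_val_zero, Matrix.cons_val_one, Matrix.cons_val_two, Matrix.head_cons, Matrix.tail_cons,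
    Equiv.Perm.coe_one, id, Equiv.swap_apply_of_ne_of_ne, ne_eq, Fin.reduceEq, not_false_eq_true]
    at k0 k1 k2 k3
  rcases hμ with h | h | h | h <;> simp only [Prod.mk.injEq] at h <;> obtain ⟨rfl, rfl, rfl⟩ := h
  · simp only [if_true]
    linarith [k0]
  · simp
    linarith [k1]
  · simp
    linarith [k2]
  · simp
    linarith [k3]

/-- **The pump's right-hand side IS Tao's viscous lattice law.**  With `lam = (1+ε₀)^{5/2}` (so the gain
`lam^{n-μ₃} = (1+ε₀)^{5(n-μ₃)/2}` and the dissipation `lam^{4n/5} = (1+ε₀)^{2n}`):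
`rhsF lam coeff X i n t = quadTerm ε₀ α X i n t - 1·(1+ε₀)^{2n} X_{i,n}(t)` for the pulled-back table `α` —
verbatim the `ν = 1` case of `ViscousGlobal.motion`'s right-hand side.
[cite: Tao2016AveragedNS, §4 (4.1), Lemma 4.1 (4.8) and the viscous equation displayed before Thm. 4.2] -/
theorem rhsF_eq_quadTerm_sub {ε₀ lam : ℝ} (hε : 0 < 1 + ε₀) (hlam : (1 + ε₀) ^ ((5 : ℝ) / 2) = lam)
    (coeff : Fin m → Fin m → Fin m → Option (Fin 3) → ℝ) (X : Fin m → ℤ → ℝ → ℝ) (i : Fin m) (n : ℤ)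
    (t : ℝ) :
    rhsF lam coeff X i n t =
      quadTerm ε₀ (fun (i₁ i₂ i₃ : Fin m) (μ : ℤ × ℤ × ℤ) =>
        if μ = (0, 0, 0) then coeff i₁ i₂ i₃ none
        else if μ = (1, 0, 0) then coeff i₁ i₂ i₃ (some 0)
        else if μ = (0, 1, 0) then coeff i₁ i₂ i₃ (some 1)
        else if μ = (0, 0, 1) then coeff i₁ i₂ i₃ (some 2) else 0) X i n t -
      1 * (1 + ε₀) ^ ((2 : ℝ) * n) * X i n t := by
  have hlam0 : 0 < lam := by rw [← hlam]; exact Real.rpow_pos_of_pos hε _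
  -- powers
  have hp : ∀ s : ℝ, (1 + ε₀) ^ ((5 : ℝ) * s / 2) = lam ^ s := by
    intro s
    rw [← hlam, ← Real.rpow_mul hε.le]
    congr 1
    ring
  have e0 : (1 + ε₀) ^ ((5 : ℝ) * (n : ℝ) / 2) = lam ^ n := (hp n).trans (Real.rpow_intCast lam n)
  have e1 : (1 + ε₀) ^ ((5 : ℝ) * ((n : ℝ) - 1) / 2) = lam ^ ((n : ℝ) - 1) := hp _
  have ev : (1 + ε₀) ^ ((2 : ℝ) * n) = lam ^ ((4 / 5 : ℝ) * n) := by
    rw [← hlam, ← Real.rpow_mul hε.le]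
    congr 1
    ring
  -- expand both sides
  unfold rhsF quadTerm
  rw [ev]
  have hS : shiftSet = {((0 : ℤ), (0 : ℤ), (0 : ℤ)), (1, 0, 0), (0, 1, 0), (0, 0, 1)} := rfl
  simp only [hS]
  have hsum : ∀ i₁ i₂ : Fin m,
      (∑ μ ∈ ({((0 : ℤ), (0 : ℤ), (0 : ℤ)), (1, 0, 0), (0, 1, 0), (0, 0, 1)} : Finset (ℤ × ℤ × ℤ)),
        (fun (i₁ i₂ i₃ : Fin m) (μ : ℤ × ℤ × ℤ) =>
            if μ = (0, 0, 0) then coeff i₁ i₂ i₃ none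
            else if μ = (1, 0, 0) then coeff i₁ i₂ i₃ (some 0)
            else if μ = (0, 1, 0) then coeff i₁ i₂ i₃ (some 1)
            else if μ = (0, 0, 1) then coeff i₁ i₂ i₃ (some 2) else 0) i₁ i₂ i μ *
          (1 + ε₀) ^ ((5 : ℝ) * (n - μ.2.2) / 2) * (X i₁ (n - μ.2.2 + μ.1) t * X i₂ (n - μ.2.2 + μ.2.1) t)) =
      ∑ μ : Option (Fin 3), coeff i₁ i₂ i μ * lam ^ ((n : ℝ) - (if μ = some 2 then 1 else 0)) *
          X i₁ (n + ((if μ = some 0 then 1 else 0) - (if μ = some 2 then 1 else 0))) t *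
          X i₂ (n + ((if μ = some 1 then 1 else 0) - (if μ = some 2 then 1 else 0))) t := by
    intro i₁ i₂
    rw [Finset.sum_insert (by decide), Finset.sum_insert (by decide), Finset.sum_insert (by decide),
      Finset.sum_singleton]
    rw [Fintype.sum_option, Fin.sum_univ_three]
    simp
    rw [e0, e1]
    have i1 : n + -1 = n - 1 := by ring
    simp only [i1]
    ring
  simp only [hsum]
  ring

end Summit.NavierStokesRegularity.NavierStokesRegularity.Theorems.WakeRatchetCircuitPumpTable

end
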